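/-
Copyright (c) 2026 the pub-hodgecm-mathlib formalisation cell (harness21).  Prover seat hodgecm-mathlib-A-p03 (g24); LEAD F0P3a-plan (g9) WORD T8-81 «LAYER B_H»;
inputs: B-p12 (g28) γ2′ literals (★ `UnitaryThreeRamifiedTorusDoubleCosetsHKDisjoint`), 2026-09-01.
-/
import Literature.NumberTheory.Rogawski1990.UnitOrbitalIntegralInertCountGeneralRatio     -- ★ Prop. 10, general ratio, packaged
import Literature.NumberTheory.Rogawski1990.UnitOrbitalIntegralInertCountJPosVanishing   -- ★ `natCard_cosets_eq_zero_of_one_lt`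
import Literature.NumberTheory.Automorphic.UnitaryThreeKHFactorization                   -- ★ `block_relations_of_coe_eq`
import HarnessLib

/-!
# LAYER B_H: Flicker's Prop. 10, `T_H` clause, AT THE RAMIFIED-TORUS LITERAL — `#{y ∈ P_H⧸(P_H ∩ H^K_m) : y⁻¹ (r_n⁻¹ t′ r_n) y ∈ H^K_m} = iTen q (N − n) N₊ m`

Topic `NumberTheory/Rogawski1990` (road «D-N7-inert», MAP v3 (F11) LAYER B_H); namespace `Literature.NumberTheory.Automorphic.UnitaryGroup`.  THEOREMS ONLY; kernel lane.

B-p12's γ2′ frame (★ `UnitaryThreeRamifiedTorusDoubleCosetsHKDisjoint`): the type-(2) torus element `t′ = !![A,0,B; 0,b₀,0; C,0,A] ∈ H` with `B = C·ρ`, `|ρ| = |ϖ|`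
(`ρ = π∕D`, σ-fixed), `|C| = |ϖ^N|`, and the ramified representatives `r(2a) = diag(ϖ^{−a},1,ϖ^a)`, `r(2a+1)` with corner `(0, ϖ^{a+1}∕d; −dϖ^{−(a+1)}, 0)`
(`σd = −d`, `|d| = 1`).  This file computes the conjugates' corners (§1: `!![A,0,B₁; 0,b₀,0; B₂,0,A]` with `B₁ = B₂·p`, `p = ρϖ^{4a}` resp. `ϖ^{4a+4}∕(ρd⁴)` —
σ-fixed of odd positive order — and `|B₂| = |ϖ^{N−n}|`), the σ-DEFECT of `d = 2(A−b₀)∕B₂` from the corner's unitarity relations (§2: `map_ratio_sub_ratio_block`,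
`|σs − s|·|ϖ^N| ≤ max(|ϖ|^{2N+1}, |ϖ|^{2N₊})` for `s = (A−b₀)∕C` — the type-(2) substitute for ★ `map_ratio_sub_ratio`), and concludes (§3) from ★
`natCard_cosets_eq_iTen_gen_of_package`: **`natCard_cosets_ramifiedTorus_even_eq_iTen`**, **`natCard_cosets_ramifiedTorus_odd_eq_iTen`** (`n ≤ N`), the
table `iTen q (N − n) N₊ m` with `N₊ := ord(A − b₀)` (Flicker p. 87: `= min(1+N₂, 1+2N)`; ★ `iTen_min_eq_iTen_of_le` turns it into the printed `1+N₂` table).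
HONEST LABEL: HC_CM is proved only modulo the printed citations until rung 0 closes.

## References
* [Flicker1998UnitaryFL] Y. Z. Flicker, *Elementary proof of the fundamental lemma for a unitary group*, Canad. J. Math. 50 (1998), 74–98: Prop. 6 p. 83, Prop. 10 p. 85,
  proof («in the ramified case») p. 87.
* [Rogawski1990] J. D. Rogawski, *Automorphic Representations of Unitary Groups in Three Variables* (1990), §4.9 p. 55.
-/

set_option autoImplicit false

open scoped MatrixGroups WithZero Valued
open Matrix

namespace Literature.NumberTheory.Automorphic

namespace UnitaryGroup

open Literature.NumberTheory.Automorphic.HermitianLattice (unitaryInt mem_unitaryInt_iff LocalConjDatum)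
open Literature.NumberTheory.Rogawski1990.Flicker1998 (iTen)
open IsLocalRing

variable {K : Type*} [Field K] [Valued K ℤᵐ⁰] {ϖ : K} (σ : K →+* K) {J : Matrix (Fin 3) (Fin 3) K}

/-! ## §1 The conjugates' corners -/

omit [Valued K ℤᵐ⁰] in
/-- **Even representative**: `diag(u⁻¹,1,u)⁻¹ · t′ · diag(u⁻¹,1,u) = !![A,0,B·u·u; 0,b₀,0; C·u⁻¹·u⁻¹,0,A]` (`u = ϖ^a`).
[cite: Flicker1998UnitaryFL, Prop. 6 p. 83; Prop. 10 p. 85] -/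
theorem coe_diag_inv_mul_block_mul_diag {t r : ↥(unitaryGroupOfForm σ J)} {A B C b₀ u : K} (hu : u ≠ 0)
    (hte : ((t : GL (Fin 3) K) : Matrix (Fin 3) (Fin 3) K) = !![A, 0, B; 0, b₀, 0; C, 0, A])
    (hr : ((r : GL (Fin 3) K) : Matrix (Fin 3) (Fin 3) K) = !![u⁻¹, 0, 0; 0, 1, 0; 0, 0, u]) :
    (((r⁻¹ * t * r : ↥(unitaryGroupOfForm σ J)) : GL (Fin 3) K) : Matrix (Fin 3) (Fin 3) K) =
      !![A, 0, B * u * u; 0, b₀, 0; C * u⁻¹ * u⁻¹, 0, A] := by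
  have key : ((t : GL (Fin 3) K) : Matrix (Fin 3) (Fin 3) K) * ((r : GL (Fin 3) K) : Matrix (Fin 3) (Fin 3) K) =
      ((r : GL (Fin 3) K) : Matrix (Fin 3) (Fin 3) K) * !![A, 0, B * u * u; 0, b₀, 0; C * u⁻¹ * u⁻¹, 0, A] := by
    rw [hte, hr]
    ext k l
    fin_cases k <;> fin_cases l <;> simp [Matrix.mul_apply, Fin.sum_univ_three] <;> field_simp
  rw [Subgroup.coe_mul, Subgroup.coe_mul, Units.val_mul, Units.val_mul, Matrix.mul_assoc, key, ← Matrix.mul_assoc, Subgroup.coe_inv,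
    Units.inv_mul, Matrix.one_mul]

omit [Valued K ℤᵐ⁰] in
/-- **Odd representative**: for `r` with matrix `!![0,0,x; 0,1,0; z,0,0]` (`x z ≠ 0`; B-p12's `x = ϖ^{a+1}∕d`, `z = −dϖ^{−(a+1)}`):
`r⁻¹ · t′ · r = !![A,0,C·x∕z; 0,b₀,0; B·z∕x,0,A]` — the antidiagonal twist swaps and rescales the off-diagonal corner entries.
[cite: Flicker1998UnitaryFL, Prop. 6 p. 83; Prop. 10 p. 85] -/
theorem coe_antidiag_inv_mul_block_mul_antidiag {t r : ↥(unitaryGroupOfForm σ J)} {A B C b₀ x z : K} (hx : x ≠ 0) (hz : z ≠ 0)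
    (hte : ((t : GL (Fin 3) K) : Matrix (Fin 3) (Fin 3) K) = !![A, 0, B; 0, b₀, 0; C, 0, A])
    (hr : ((r : GL (Fin 3) K) : Matrix (Fin 3) (Fin 3) K) = !![0, 0, x; 0, 1, 0; z, 0, 0]) :
    (((r⁻¹ * t * r : ↥(unitaryGroupOfForm σ J)) : GL (Fin 3) K) : Matrix (Fin 3) (Fin 3) K) =
      !![A, 0, C * x / z; 0, b₀, 0; B * z / x, 0, A] := by
  have key : ((t : GL (Fin 3) K) : Matrix (Fin 3) (Fin 3) K) * ((r : GL (Fin 3) K) : Matrix (Fin 3) (Fin 3) K) =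
      ((r : GL (Fin 3) K) : Matrix (Fin 3) (Fin 3) K) * !![A, 0, C * x / z; 0, b₀, 0; B * z / x, 0, A] := by
    rw [hte, hr]
    ext k l
    fin_cases k <;> fin_cases l <;> simp [Matrix.mul_apply, Fin.sum_univ_three] <;> field_simp
  rw [Subgroup.coe_mul, Subgroup.coe_mul, Units.val_mul, Units.val_mul, Matrix.mul_assoc, key, ← Matrix.mul_assoc, Subgroup.coe_inv,
    Units.inv_mul, Matrix.one_mul]

/-! ## §2 The σ-defect of `s = (A − b₀)∕C` from the corner's unitarity -/

omit [Valued K ℤᵐ⁰] in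
/-- **`σs − s` for `s = (A − b₀)∕C`** in terms of the corner's unitarity relations `σA·A + σC·B = 1`, `σA·C + σC·A = 0`, `σb₀·b₀ = 1`, `B = Cρ`:
`σs − s = (ρCσC − (A−b₀)σ(A−b₀)) ∕ (σA·C)` (the type-(2) substitute for ★ `map_ratio_sub_ratio`). [cite: Flicker1998UnitaryFL, p. 87] -/
theorem map_ratio_sub_ratio_block {A B C b₀ ρ : K} (hU1 : σ A * A + σ C * B = 1) (hU2 : σ A * C + σ C * A = 0) (hb : σ b₀ * b₀ = 1)
    (hBC : B = C * ρ) (hA : A ≠ 0) (hC : C ≠ 0) (hb0 : b₀ ≠ 0) (hσA : σ A ≠ 0) :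
    σ ((A - b₀) / C) - (A - b₀) / C = (ρ * C * σ C - (A - b₀) * (σ A - σ b₀)) / (σ A * C) := by
  have hσC : σ C = -(σ A * C / A) := by field_simp; linear_combination hU2
  have hσb : σ b₀ = b₀⁻¹ := eq_inv_of_mul_eq_one_left hb
  have hU1' : σ A * A ^ 2 - σ A * C ^ 2 * ρ = A := by
    rw [hσC, hBC] at hU1
    field_simp at hU1
    linear_combination hU1
  rw [map_div₀, map_sub, hσC, hσb]
  field_simp
  linear_combination (-b₀) * hU1'

/-- **The σ-defect bound**: with `|ρ| = |ϖ|`, `|C| = |ϖ^N|`, `|A − b₀| = |ϖ^{N₊}|`: `|σs − s|·|ϖ^N| ≤ max(|ϖ^{2N+1}|, |ϖ^{2N₊}|)` (`|A| = |σA| = 1` is forced by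
`σA·A = 1 − σC·Cρ`). [cite: Flicker1998UnitaryFL, p. 87] -/
theorem v_map_ratio_sub_ratio_block_le (hd : LocalConjDatum σ ϖ) {A B C b₀ ρ : K} (hU1 : σ A * A + σ C * B = 1) (hU2 : σ A * C + σ C * A = 0)
    (hb : σ b₀ * b₀ = 1) (hBC : B = C * ρ) (hvρ : Valued.v ρ = Valued.v ϖ) {N Np : ℕ} (hvC : Valued.v C = Valued.v (ϖ ^ N))
    (hs : Valued.v (A - b₀) = Valued.v (ϖ ^ Np)) :
    Valued.v (σ ((A - b₀) / C) - (A - b₀) / C) * Valued.v (ϖ ^ N) ≤ max (Valued.v (ϖ ^ (2 * N + 1))) (Valued.v (ϖ ^ (2 * Np))) := by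
  have hϖ0 : ϖ ≠ 0 := hd.ϖ_ne_zero
  have hC : C ≠ 0 := fun h => by rw [h, map_zero] at hvC; exact (pow_ne_zero _ hϖ0) ((map_eq_zero _).1 hvC.symm)
  have hb0 : b₀ ≠ 0 := fun h => by rw [h, mul_zero] at hb; exact zero_ne_one hb
  have hsmall : Valued.v (σ C * B) < 1 := by
    rw [hBC, map_mul, map_mul, hd.vσ, hvC, hvρ, hd.v_pow, hd.vϖ, ← WithZero.exp_add, ← WithZero.exp_add, ← WithZero.exp_zero,
      WithZero.exp_lt_exp]; omega
  have hAA : Valued.v (σ A * A) = 1 := by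
    have : σ A * A = 1 + -(σ C * B) := by linear_combination hU1
    rw [this, Valuation.map_add_eq_of_lt_left _ (by rwa [Valuation.map_one, Valuation.map_neg]), Valuation.map_one]
  have hvA : Valued.v A = 1 := by
    rw [map_mul, hd.vσ] at hAA
    exact Literature.NumberTheory.QuadraticForms.OMeara65.WithZeroMulInt.eq_one_of_mul_self hAA
  have hA : A ≠ 0 := fun h => by rw [h, map_zero] at hvA; exact zero_ne_one hvA
  have hσA : σ A ≠ 0 := fun h => hA (by rw [← hd.σσ A, h, map_zero])
  rw [map_ratio_sub_ratio_block σ hU1 hU2 hb hBC hA hC hb0 hσA, map_div₀, map_mul, hd.vσ, hvA, one_mul, hvC,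
    div_mul_cancel₀ _ (by rw [hd.v_pow]; exact WithZero.coe_ne_zero)]
  refine le_trans (Valuation.map_sub _ _ _) (max_le_max ?_ ?_)
  · rw [map_mul, map_mul, hd.vσ, hvρ, hvC, hd.v_pow, hd.v_pow, hd.vϖ, ← WithZero.exp_add, ← WithZero.exp_add, WithZero.exp_le_exp]; omega
  · rw [map_mul, ← map_sub, hd.vσ, hs, hd.v_pow, hd.v_pow, ← WithZero.exp_add, WithZero.exp_le_exp]; omega

/-! ## §3 Prop. 10, `T_H` clause, at the ramified-torus literal -/

section TH

variable [IsDiscreteValuationRing 𝒪[K]] [Finite (ResidueField 𝒪[K])] [IsAdicComplete (maximalIdeal 𝒪[K]) 𝒪[K]]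

omit [IsDiscreteValuationRing 𝒪[K]] [Finite (ResidueField 𝒪[K])] [IsAdicComplete (maximalIdeal 𝒪[K]) 𝒪[K]] in
/-- The regime-4 σ-defect at the conjugate: if `2(A−b₀)∕B₂ = κ·(A−b₀)∕C` with `κ` σ-fixed, `|κ| = |ϖ^n|`, then under `N₊ = ν = N − n`, `m ≤ ν < 2m`:
`|σd − d| ≤ |ϖ^{2m−ν}|`. [cite: Flicker1998UnitaryFL, p. 87] -/
theorem v_defect_le_of_block (hd : LocalConjDatum σ ϖ) {A B C b₀ ρ B₂ κ : K} (hU1 : σ A * A + σ C * B = 1) (hU2 : σ A * C + σ C * A = 0)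
    (hb : σ b₀ * b₀ = 1) (hBC : B = C * ρ) (hvρ : Valued.v ρ = Valued.v ϖ) {N Np n m : ℕ} (hvC : Valued.v C = Valued.v (ϖ ^ N))
    (hs : Valued.v (A - b₀) = Valued.v (ϖ ^ Np)) (hdκ : 2 * (A - b₀) / B₂ = κ * ((A - b₀) / C)) (hσκ : σ κ = κ)
    (hvκ : Valued.v κ = Valued.v (ϖ ^ n)) (hNp : Np = N - n) (hn : n ≤ N) (hm : m ≤ N - n) (h2m : N - n < 2 * m) :
    Valued.v (σ (2 * (A - b₀) / B₂) - 2 * (A - b₀) / B₂) ≤ Valued.v (ϖ ^ (2 * m - (N - n))) := by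
  have hdiff : σ (2 * (A - b₀) / B₂) - 2 * (A - b₀) / B₂ = κ * (σ ((A - b₀) / C) - (A - b₀) / C) := by
    rw [hdκ, map_mul, hσκ]; ring
  have key := v_map_ratio_sub_ratio_block_le σ hd hU1 hU2 hb hBC hvρ hvC hs
  have hpos : 0 < Valued.v (ϖ ^ N) := by rw [hd.v_pow]; exact WithZero.zero_lt_coe _
  have hne : Valued.v (ϖ ^ N) ≠ 0 := ne_of_gt hpos
  have h1 : Valued.v (σ (2 * (A - b₀) / B₂) - 2 * (A - b₀) / B₂) * Valued.v (ϖ ^ N) ≤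
      Valued.v (ϖ ^ (2 * m - (N - n))) * Valued.v (ϖ ^ N) := by
    rw [hdiff, map_mul, mul_assoc]
    refine le_trans (mul_le_mul_right key _) ?_
    rw [hvκ]
    rcases le_total (Valued.v (ϖ ^ (2 * N + 1))) (Valued.v (ϖ ^ (2 * Np))) with h | h
    · rw [max_eq_right h, hd.v_pow, hd.v_pow, hd.v_pow, hd.v_pow, ← WithZero.exp_add, ← WithZero.exp_add, WithZero.exp_le_exp]; omega
    · rw [max_eq_left h, hd.v_pow, hd.v_pow, hd.v_pow, hd.v_pow, ← WithZero.exp_add, ← WithZero.exp_add, WithZero.exp_le_exp]; omega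
  have := (le_div_iff₀ hpos).2 h1
  rwa [mul_div_cancel_right₀ _ hne] at this

/-- **PROP. 10, `T_H` CLAUSE, EVEN REPRESENTATIVE** `r = diag(ϖ^{−a},1,ϖ^a)` (`2a ≤ N`): for B-p12's ramified torus literal `t′ = !![A,0,Cρ; 0,b₀,0; C,0,A]`
(`|ρ| = |ϖ|`, `σρ = ρ`, `|C| = |ϖ^N|`, `|A − b₀| = |ϖ^{N₊}|`), `#{y ∈ P_H⧸(P_H ∩ H^K_m) : y⁻¹(r⁻¹t′r)y ∈ H^K_m} = iTen q (N − 2a) N₊ m`.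
[cite: Flicker1998UnitaryFL, Prop. 10 p. 85, p. 87] -/
theorem natCard_cosets_ramifiedTorus_even_eq_iTen (hJ : J = (StdForm.antidiagonal 3).over K) (hd : LocalConjDatum σ ϖ)
    (hσO : ∀ y : 𝒪[K], (σ.comp 𝒪[K].subtype) y ∈ 𝒪[K]) {y : K} (hy : y * σ y = -2)
    {c um t r : ↥(unitaryGroupOfForm σ J)} (hc : ((c : GL (Fin 3) K) : Matrix (Fin 3) (Fin 3) K) = !![1, 0, 0; 0, -1, 0; 0, 0, 1])
    {m : ℕ} (hum : ((um : GL (Fin 3) K) : Matrix (Fin 3) (Fin 3) K) = !![ϖ ^ m, y, (ϖ ^ m)⁻¹; 0, 1, -σ y * (ϖ ^ m)⁻¹; 0, 0, (ϖ ^ m)⁻¹])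
    {A B C b₀ ρ : K} (hte : ((t : GL (Fin 3) K) : Matrix (Fin 3) (Fin 3) K) = !![A, 0, B; 0, b₀, 0; C, 0, A])
    (htH : t ∈ Subgroup.centralizer ({c} : Set ↥(unitaryGroupOfForm σ J))) (hBC : B = C * ρ) (hvρ : Valued.v ρ = Valued.v ϖ) (hσρ : σ ρ = ρ)
    {a : ℕ} (hr : ((r : GL (Fin 3) K) : Matrix (Fin 3) (Fin 3) K) = !![(ϖ ^ a)⁻¹, 0, 0; 0, 1, 0; 0, 0, ϖ ^ a])
    (hrH : r ∈ Subgroup.centralizer ({c} : Set ↥(unitaryGroupOfForm σ J)))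
    {N Np : ℕ} (hvC : Valued.v C = Valued.v (ϖ ^ N)) (hs : Valued.v (A - b₀) = Valued.v (ϖ ^ Np)) (haN : 2 * a ≤ N)
    {q : ℕ} (hq : Nat.card (ResidueField 𝒪[K]) = q ^ 2)
    {a₀ : 𝒪[K]} (ha₀ : IsUnit (((σ.comp 𝒪[K].subtype).codRestrict 𝒪[K] hσO) a₀ - a₀)) :
    (Nat.card {w : ↥(flickerPH σ J c) ⧸ (flickerHK σ J c um).subgroupOf (flickerPH σ J c) //
      ((Quotient.out w : ↥(flickerPH σ J c)) : ↥(unitaryGroupOfForm σ J))⁻¹ * (r⁻¹ * t * r) * (Quotient.out w : ↥(flickerPH σ J c)) ∈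
        flickerHK σ J c um} : ℚ) = iTen q (N - 2 * a) Np m := by
  have hϖ0 : ϖ ≠ 0 := hd.ϖ_ne_zero
  have hpa : ϖ ^ a ≠ 0 := pow_ne_zero _ hϖ0
  obtain ⟨hU2, hU1, -, -, hb⟩ := block_relations_of_coe_eq σ hJ t hte
  have hC : C ≠ 0 := fun h => by rw [h, map_zero] at hvC; exact hpa.elim |> fun _ => (pow_ne_zero _ hϖ0) ((map_eq_zero _).1 hvC.symm)
  have hρ0 : ρ ≠ 0 := fun h => by rw [h, map_zero] at hvρ; exact hϖ0 ((map_eq_zero _).1 hvρ.symm)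
  have hτ := coe_diag_inv_mul_block_mul_diag σ hpa hte hr
  have hτH : r⁻¹ * t * r ∈ Subgroup.centralizer ({c} : Set ↥(unitaryGroupOfForm σ J)) :=
    Subgroup.mul_mem _ (Subgroup.mul_mem _ (Subgroup.inv_mem _ hrH) htH) hrH
  have hB₁ : B * ϖ ^ a * ϖ ^ a = C * (ϖ ^ a)⁻¹ * (ϖ ^ a)⁻¹ * (ρ * (ϖ ^ a * ϖ ^ a * (ϖ ^ a * ϖ ^ a))) := by
    rw [hBC]; field_simp
  have hvp : Valued.v (ρ * (ϖ ^ a * ϖ ^ a * (ϖ ^ a * ϖ ^ a))) < 1 := by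
    have e4 : ρ * (ϖ ^ a * ϖ ^ a * (ϖ ^ a * ϖ ^ a)) = ρ * ϖ ^ (4 * a) := by ring
    rw [e4, map_mul, hvρ, hd.vϖ, hd.v_pow, ← WithZero.exp_add, ← WithZero.exp_zero, WithZero.exp_lt_exp]; omega
  have hσp : σ (ρ * (ϖ ^ a * ϖ ^ a * (ϖ ^ a * ϖ ^ a))) = ρ * (ϖ ^ a * ϖ ^ a * (ϖ ^ a * ϖ ^ a)) := by
    simp only [map_mul, map_pow, hσρ, hd.σϖ]
  have hB₂ : Valued.v (C * (ϖ ^ a)⁻¹ * (ϖ ^ a)⁻¹) = Valued.v (ϖ ^ (N - 2 * a)) := by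
    rw [map_mul, map_mul, map_inv₀, hvC, hd.v_pow, hd.v_pow, hd.v_pow, ← WithZero.exp_neg, ← WithZero.exp_add, ← WithZero.exp_add,
      WithZero.exp_inj]; omega
  have hdκ : 2 * (A - b₀) / (C * (ϖ ^ a)⁻¹ * (ϖ ^ a)⁻¹) = (2 * (ϖ ^ a * ϖ ^ a)) * ((A - b₀) / C) := by field_simp
  have hσκ : σ (2 * (ϖ ^ a * ϖ ^ a)) = 2 * (ϖ ^ a * ϖ ^ a) := by simp only [map_mul, map_ofNat, map_pow, hd.σϖ]
  have hvκ : Valued.v (2 * (ϖ ^ a * ϖ ^ a)) = Valued.v (ϖ ^ (2 * a)) := by rw [map_mul, hd.v2, one_mul, ← pow_add, two_mul]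
  have hσd : Np = N - 2 * a → m ≤ N - 2 * a → N - 2 * a < 2 * m →
      Valued.v (σ (2 * (A - b₀) / (C * (ϖ ^ a)⁻¹ * (ϖ ^ a)⁻¹)) - 2 * (A - b₀) / (C * (ϖ ^ a)⁻¹ * (ϖ ^ a)⁻¹)) ≤
        Valued.v (ϖ ^ (2 * m - (N - 2 * a))) := fun h1 h2 h3 =>
    v_defect_le_of_block σ hd hU1 hU2 hb hBC hvρ hvC hs hdκ hσκ hvκ h1 haN h2 h3
  exact natCard_cosets_eq_iTen_gen_of_package σ hJ hd hσO hy hc hum hB₁ hvp hσp hτ hτH hB₂ hs hσd hq ha₀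

/-- **PROP. 10, `T_H` CLAUSE, ODD REPRESENTATIVE** `r` with corner `(0, ϖ^{a+1}∕d; −dϖ^{−(a+1)}, 0)` (`σd = −d`, `|d| = 1`, `2a+1 ≤ N`): for B-p12's ramified
torus literal `t′`, `#{y ∈ P_H⧸(P_H ∩ H^K_m) : y⁻¹(r⁻¹t′r)y ∈ H^K_m} = iTen q (N − (2a+1)) N₊ m`. [cite: Flicker1998UnitaryFL, Prop. 10 p. 85, p. 87] -/
theorem natCard_cosets_ramifiedTorus_odd_eq_iTen (hJ : J = (StdForm.antidiagonal 3).over K) (hd : LocalConjDatum σ ϖ)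
    (hσO : ∀ y : 𝒪[K], (σ.comp 𝒪[K].subtype) y ∈ 𝒪[K]) {y : K} (hy : y * σ y = -2)
    {c um t r : ↥(unitaryGroupOfForm σ J)} (hc : ((c : GL (Fin 3) K) : Matrix (Fin 3) (Fin 3) K) = !![1, 0, 0; 0, -1, 0; 0, 0, 1])
    {m : ℕ} (hum : ((um : GL (Fin 3) K) : Matrix (Fin 3) (Fin 3) K) = !![ϖ ^ m, y, (ϖ ^ m)⁻¹; 0, 1, -σ y * (ϖ ^ m)⁻¹; 0, 0, (ϖ ^ m)⁻¹])
    {A B C b₀ ρ : K} (hte : ((t : GL (Fin 3) K) : Matrix (Fin 3) (Fin 3) K) = !![A, 0, B; 0, b₀, 0; C, 0, A])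
    (htH : t ∈ Subgroup.centralizer ({c} : Set ↥(unitaryGroupOfForm σ J))) (hBC : B = C * ρ) (hvρ : Valued.v ρ = Valued.v ϖ) (hσρ : σ ρ = ρ)
    {d : K} (hvd : Valued.v d = 1) (hσd : σ d = -d) {a : ℕ}
    (hr : ((r : GL (Fin 3) K) : Matrix (Fin 3) (Fin 3) K) = !![0, 0, ϖ ^ (a + 1) / d; 0, 1, 0; -d * (ϖ ^ (a + 1))⁻¹, 0, 0])
    (hrH : r ∈ Subgroup.centralizer ({c} : Set ↥(unitaryGroupOfForm σ J)))
    {N Np : ℕ} (hvC : Valued.v C = Valued.v (ϖ ^ N)) (hs : Valued.v (A - b₀) = Valued.v (ϖ ^ Np)) (haN : 2 * a + 1 ≤ N)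
    {q : ℕ} (hq : Nat.card (ResidueField 𝒪[K]) = q ^ 2)
    {a₀ : 𝒪[K]} (ha₀ : IsUnit (((σ.comp 𝒪[K].subtype).codRestrict 𝒪[K] hσO) a₀ - a₀)) :
    (Nat.card {w : ↥(flickerPH σ J c) ⧸ (flickerHK σ J c um).subgroupOf (flickerPH σ J c) //
      ((Quotient.out w : ↥(flickerPH σ J c)) : ↥(unitaryGroupOfForm σ J))⁻¹ * (r⁻¹ * t * r) * (Quotient.out w : ↥(flickerPH σ J c)) ∈
        flickerHK σ J c um} : ℚ) = iTen q (N - (2 * a + 1)) Np m := by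
  have hϖ0 : ϖ ≠ 0 := hd.ϖ_ne_zero
  have hpa : ϖ ^ (a + 1) ≠ 0 := pow_ne_zero _ hϖ0
  have hd0 : d ≠ 0 := fun h => by rw [h, map_zero] at hvd; exact zero_ne_one hvd
  obtain ⟨hU2, hU1, -, -, hb⟩ := block_relations_of_coe_eq σ hJ t hte
  have hC : C ≠ 0 := fun h => by rw [h, map_zero] at hvC; exact (pow_ne_zero _ hϖ0) ((map_eq_zero _).1 hvC.symm)
  have hρ0 : ρ ≠ 0 := fun h => by rw [h, map_zero] at hvρ; exact hϖ0 ((map_eq_zero _).1 hvρ.symm)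
  have hB0 : B ≠ 0 := by rw [hBC]; exact mul_ne_zero hC hρ0
  have hx : ϖ ^ (a + 1) / d ≠ 0 := div_ne_zero hpa hd0
  have hz : -d * (ϖ ^ (a + 1))⁻¹ ≠ 0 := mul_ne_zero (neg_ne_zero.2 hd0) (inv_ne_zero hpa)
  have hτ := coe_antidiag_inv_mul_block_mul_antidiag σ hx hz hte hr
  have hτH : r⁻¹ * t * r ∈ Subgroup.centralizer ({c} : Set ↥(unitaryGroupOfForm σ J)) :=
    Subgroup.mul_mem _ (Subgroup.mul_mem _ (Subgroup.inv_mem _ hrH) htH) hrH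
  -- valuations of `x = ϖ^{a+1}∕d`, `z = −dϖ^{−(a+1)}`
  have hvx : Valued.v (ϖ ^ (a + 1) / d) = Valued.v (ϖ ^ (a + 1)) := by rw [map_div₀, hvd, div_one]
  have hvz : Valued.v (-d * (ϖ ^ (a + 1))⁻¹) = (Valued.v (ϖ ^ (a + 1)))⁻¹ := by rw [map_mul, Valuation.map_neg, hvd, one_mul, map_inv₀]
  -- the ratio `p′ = x²∕(ρ z²)`
  have hB₁ : C * (ϖ ^ (a + 1) / d) / (-d * (ϖ ^ (a + 1))⁻¹) =
      B * (-d * (ϖ ^ (a + 1))⁻¹) / (ϖ ^ (a + 1) / d) *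
        ((ϖ ^ (a + 1) / d) * (ϖ ^ (a + 1) / d) / (ρ * ((-d * (ϖ ^ (a + 1))⁻¹) * (-d * (ϖ ^ (a + 1))⁻¹)))) := by
    rw [hBC]; field_simp
  have hvp : Valued.v ((ϖ ^ (a + 1) / d) * (ϖ ^ (a + 1) / d) / (ρ * ((-d * (ϖ ^ (a + 1))⁻¹) * (-d * (ϖ ^ (a + 1))⁻¹)))) < 1 := by
    rw [map_div₀, map_mul, map_mul, map_mul, hvx, hvz, hvρ, hd.v_pow, hd.vϖ, ← WithZero.exp_neg, ← WithZero.exp_add, ← WithZero.exp_add,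
      ← WithZero.exp_add, ← WithZero.exp_sub, ← WithZero.exp_zero, WithZero.exp_lt_exp]; omega
  have hσp : σ ((ϖ ^ (a + 1) / d) * (ϖ ^ (a + 1) / d) / (ρ * ((-d * (ϖ ^ (a + 1))⁻¹) * (-d * (ϖ ^ (a + 1))⁻¹)))) =
      (ϖ ^ (a + 1) / d) * (ϖ ^ (a + 1) / d) / (ρ * ((-d * (ϖ ^ (a + 1))⁻¹) * (-d * (ϖ ^ (a + 1))⁻¹))) := by
    simp only [map_div₀, map_mul, map_neg, map_pow, map_inv₀, hσρ, hσd, hd.σϖ]; ring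
  have hB₂ : Valued.v (B * (-d * (ϖ ^ (a + 1))⁻¹) / (ϖ ^ (a + 1) / d)) = Valued.v (ϖ ^ (N - (2 * a + 1))) := by
    rw [map_div₀, map_mul, hvz, hvx, hBC, map_mul, hvC, hvρ, hd.v_pow, hd.v_pow, hd.v_pow, hd.vϖ, ← WithZero.exp_neg, ← WithZero.exp_add,
      ← WithZero.exp_add, ← WithZero.exp_sub, WithZero.exp_inj]; omega
  have hdκ : 2 * (A - b₀) / (B * (-d * (ϖ ^ (a + 1))⁻¹) / (ϖ ^ (a + 1) / d)) =
      (2 * (ϖ ^ (a + 1) / d) / (ρ * (-d * (ϖ ^ (a + 1))⁻¹))) * ((A - b₀) / C) := by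
    rw [hBC]; field_simp
  have hσκ : σ (2 * (ϖ ^ (a + 1) / d) / (ρ * (-d * (ϖ ^ (a + 1))⁻¹))) = 2 * (ϖ ^ (a + 1) / d) / (ρ * (-d * (ϖ ^ (a + 1))⁻¹)) := by
    simp only [map_div₀, map_mul, map_neg, map_ofNat, map_pow, map_inv₀, hσρ, hσd, hd.σϖ]; field_simp
  have hvκ : Valued.v (2 * (ϖ ^ (a + 1) / d) / (ρ * (-d * (ϖ ^ (a + 1))⁻¹))) = Valued.v (ϖ ^ (2 * a + 1)) := by
    rw [map_div₀, map_mul, hd.v2, one_mul, map_mul, hvx, hvz, hvρ, hd.v_pow, hd.v_pow, hd.vϖ, ← WithZero.exp_neg, ← WithZero.exp_add,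
      ← WithZero.exp_sub, WithZero.exp_inj]; omega
  have hσdd : Np = N - (2 * a + 1) → m ≤ N - (2 * a + 1) → N - (2 * a + 1) < 2 * m →
      Valued.v (σ (2 * (A - b₀) / (B * (-d * (ϖ ^ (a + 1))⁻¹) / (ϖ ^ (a + 1) / d))) -
        2 * (A - b₀) / (B * (-d * (ϖ ^ (a + 1))⁻¹) / (ϖ ^ (a + 1) / d))) ≤ Valued.v (ϖ ^ (2 * m - (N - (2 * a + 1)))) := fun h1 h2 h3 =>
    v_defect_le_of_block σ hd hU1 hU2 hb hBC hvρ hvC hs hdκ hσκ hvκ h1 haN h2 h3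
  exact natCard_cosets_eq_iTen_gen_of_package σ hJ hd hσO hy hc hum hB₁ hvp hσp hτ hτH hB₂ hs hσdd hq ha₀

end TH

end UnitaryGroup

end Literature.NumberTheory.Automorphic
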